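import Literature.AlgebraicGeometry.HodgeTheory.HolomorphicBundleChernCharacterProjectiveSpace
import Literature.AlgebraicGeometry.HodgeTheory.HyperplaneClassPullback
import Literature.AlgebraicGeometry.Motives.ProjectiveNoetherNormalization
import Literature.AlgebraicGeometry.Motives.FunctionFieldOver
import Literature.AlgebraicGeometry.Motives.CartierDivisorCocycle
import Literature.Geometry.Kaehler.ChernCharacterPullback
import HarnessLib

/-!
# Hyperplane divisors of two morphisms to projective space: the units of a linear equivalence, read on `T^an`

Family `hodge`, layer `Literature/AlgebraicGeometry/HodgeTheory`. Scheme-side and point-wise preparations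
for `ChernCharacterTautologicalLinEquiv` (linear equivalence of hyperplane divisors transports to `ch₁` of
the tautological cocycles). For an integral `T/ℂ`, a dominant `ψ : T ⟶ ℙᴺ` and a morphism `Ψ : T ⟶ ℙᴷ`
(generating sections `ψ^*xᵢ`, `Ψ^*x_a` in chart form, `GeneratingSections.affineChartData`, Hartshorne II
Thm. 7.1 (a)):

* `GeneratingSections.ratioFn_affineChartData_comp` — the rational functions `(ι ≫ κ)^*(xᵢ/xⱼ)` are
  `ι^♯(κ^*(xᵢ/xⱼ))` (`homRatio_comp` with `functionFieldMap_ofSection`); hence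
  `GeneratingSections.functionFieldMap_hyperplane_f`: **the local equations of the pulled-back hyperplane
  divisor `ψ^*H`** (`CartierDivisor.pullback` of `ProjSpace.hyperplane`, `H = {x₀ = 0}`, Görtz–Wedhorn I
  Def. 11.49, Example 11.45) **are the ratios `ψ^*(x₀/x_l)`**;
* `GeneratingSections.exists_isUnitAt_of_linEquiv_hyperplane` — **the units of a linear equivalence
  `ψ^*H ∼ m • D_Ψ`** (`D_Ψ = (Ψ^*x_{j₀})`, `GeneratingSections.divisor`; Görtz–Wedhorn I (11.9)): an
  `h ∈ K(T)^×` with `ψ^*(x₀/xᵢ) · h / (Ψ^*(x_{j₀}/x_a))^m ∈ 𝒪_{T,y}^×` on `ψ⁻¹D₊(xᵢ) ∩ Ψ⁻¹D₊(x_a)`, and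
  `GeneratingSections.ratioFn_mul_div_pow_mul_ratioFn`, the identity of rational functions behind
  condition (C) of Fritzsche–Grauert IV §2 for these units;
* `evalOrZero_sectionOf_ne_zero`, `evalOrZero_mul_eq_pow_mul_of_ofSection` — values at complex points:
  the section of a unit does not vanish, and identities in `K(T)` hold for the values (Görtz–Wedhorn I,
  Prop. 3.29: `Γ(U, 𝒪) ⊆ K(T)`);
* `mem_tautologicalBundle_pullback_anMap_baseSet_iff`, `tautologicalBundle_pullback_anMap_coordChange_apply`
  — **the cocycle `(ψ^an)⁻¹𝒪_{ℙᴺ}(-1)`** (`SmoothComplexVectorBundle.pullback` of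
  `AnalytificationKaehler.tautologicalBundle (𝟙 ℙᴺ)` along `HodgeModel.anMap`) **has trivialising sets
  `φ⁻¹(ψ⁻¹D₊(xᵢ)(ℂ))` and transition functions `ψ^*(xᵢ/xⱼ)`** (`coordVec_comp`, `toComplexPoints_anMap`).

Everything is proved; no definitions, no named facts.

## References

* R. Hartshorne, *Algebraic Geometry* (1977), II Thm. 7.1 (a). [Hartshorne1977]
* U. Görtz, T. Wedhorn, *Algebraic Geometry I*, 2nd ed. (2020), Prop. 3.29, (11.9), Def. 11.49. [GortzWedhorn2020]
* J.-P. Serre, *Géométrie algébrique et géométrie analytique* (1956), §2 n°5. [SerreGAGA1956]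
-/

noncomputable section

open scoped Manifold ContDiff Topology
open CategoryTheory AlgebraicGeometry TopologicalSpace Opposite Set

namespace Literature.AlgebraicGeometry.HodgeTheory

open Literature.AlgebraicGeometry.Motives Literature.AlgebraicGeometry.Motives.RatFn
  Literature.AlgebraicGeometry.Motives.AlgPoints Literature.AlgebraicGeometry.Motives.AnalytificationKaehler
  Literature.NumberTheory.Transcendental Literature.Geometry.Kaehler

/-! ### Ratios of generating sections along a morphism; the pulled-back hyperplane divisor -/

section Comp

variable {k : Type} [Field k] {X Y : SchemeOver k} [IsIntegral X.left] [IsIntegral Y.left] {N : ℕ}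
  (ι : X ⟶ Y) (κ : Y ⟶ projectiveSpace N k) [IsDominant ι.left]

/-- **The rational functions `(ι ≫ κ)^*(xᵢ/xⱼ)` are the pull-backs `ι^♯(κ^*(xᵢ/xⱼ))`** along a dominant
`ι` (the ratios of a composite are the pulled-back ratios, `homRatio_comp`, and `ι^♯` is compatible with
pulling back sections, `functionFieldMap_ofSection`). [cite: Hartshorne1977, II Thm. 7.1 (a)] -/
theorem _root_.Literature.AlgebraicGeometry.Motives.GeneratingSections.ratioFn_affineChartData_comp (j i : Fin (N + 1))
    (hj : genericPoint Y.left ∈ (GeneratingSections.affineChartData κ).U j)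
    (hj' : genericPoint X.left ∈ (GeneratingSections.affineChartData (ι ≫ κ)).U j) :
    (GeneratingSections.affineChartData (ι ≫ κ)).ratioFn j i hj' =
      functionFieldMap ι.left ((GeneratingSections.affineChartData κ).ratioFn j i hj) := by
  change ofSection hj' ((GeneratingSections.affineChartData (ι ≫ κ)).ratio j i) =
    functionFieldMap ι.left (ofSection hj ((GeneratingSections.affineChartData κ).ratio j i))
  rw [functionFieldMap_ofSection, Scheme.Hom.app_eq_appLE]
  letI := MvPolynomial.gradedAlgebra (σ := Fin (N + 1)) (R := k)
  exact congrArg (ofSection _) (GeneratingSections.homRatio_comp ι.left j i κ.left)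

end Comp

section Units

variable {N K : ℕ} {T : SchemeOver ℂ} [IsIntegral T.left]

/-- **The local equations of the pulled-back hyperplane divisor `ψ^*H` of a dominant `ψ : T ⟶ ℙᴺ` are the
ratios `ψ^*(x₀/x_l)`** of the generating sections of `ψ` (`H = {x₀ = 0}` with local equation `x₀/x_l` on
`D₊(x_l)`). [cite: GortzWedhorn2020, Def. 11.49 and Example 11.45] -/
theorem _root_.Literature.AlgebraicGeometry.Motives.GeneratingSections.functionFieldMap_hyperplane_f
    (ψ : T ⟶ projectiveSpace N ℂ) (hψ : IsDominant ψ.left) (l : (ProjSpace.hyperplane N ℂ).ι)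
    (hl : genericPoint T.left ∈ (GeneratingSections.affineChartData ψ).U l.down.1) :
    @functionFieldMap (ProjSpace.P N ℂ) _ T.left _ ψ.left hψ ((ProjSpace.hyperplane N ℂ).f l) =
      (GeneratingSections.affineChartData ψ).ratioFn l.down.1 0 hl := by
  haveI : IsIntegral (projectiveSpace N ℂ).left := ProjSpace.isIntegral N ℂ
  haveI : IsDominant ψ.left := hψ
  have key : ∀ χ : T ⟶ projectiveSpace N ℂ, ψ ≫ 𝟙 _ = χ →
      ∀ hl' : genericPoint T.left ∈ (GeneratingSections.affineChartData χ).U l.down.1,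
        @functionFieldMap (ProjSpace.P N ℂ) _ T.left _ ψ.left hψ ((ProjSpace.hyperplane N ℂ).f l) =
          (GeneratingSections.affineChartData χ).ratioFn l.down.1 0 hl' := by
    rintro χ rfl hl'
    exact (GeneratingSections.ratioFn_affineChartData_comp ψ (𝟙 _) l.down.1 0 (ProjSpace.genericPoint_mem_U _) hl').symm
  exact key ψ (Category.comp_id ψ) hl

/-- **The units of a linear equivalence `ψ^*H ∼ m • D_Ψ`**, `D_Ψ` the hyperplane divisor `(Ψ^*x_{j₀})` of a
second morphism `Ψ : T ⟶ ℙᴷ` (`GeneratingSections.divisor`): an `h ∈ K(T)^×` with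
`ψ^*(x₀/xᵢ) · h / (Ψ^*(x_{j₀}/x_a))^m ∈ 𝒪_{T,y}^×` for every `y ∈ ψ⁻¹D₊(xᵢ) ∩ Ψ⁻¹D₊(x_a)` (Görtz–Wedhorn I,
(11.9): `D ∼ E` iff `f_i h / g_a ∈ Γ(U_i ∩ V_a, 𝒪^×)` for some `h`).
[cite: GortzWedhorn2020, Section (11.9) (p. 374) and Def. 11.49] -/
theorem _root_.Literature.AlgebraicGeometry.Motives.GeneratingSections.exists_isUnitAt_of_linEquiv_hyperplane
    (ψ : T ⟶ projectiveSpace N ℂ) (hψ : IsDominant ψ.left) (Ψ : T ⟶ projectiveSpace K ℂ) (j₀ : Fin (K + 1))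
    (hj₀ : genericPoint T.left ∈ (GeneratingSections.ofHom Ψ.left).U j₀) (m : ℕ)
    (hlin : (@CartierDivisor.pullback _ _ (ProjSpace.hyperplane N ℂ) T.left _ ψ.left hψ).LinEquiv
      (m • (GeneratingSections.ofHom Ψ.left).divisor j₀ hj₀)) :
    ∃ h : T.left.functionField, h ≠ 0 ∧ ∀ (i : Fin (N + 1)) (a : Fin (K + 1)) (y : T.left)
      (hi : y ∈ (GeneratingSections.affineChartData ψ).U i) (ha : y ∈ (GeneratingSections.affineChartData Ψ).U a),
      IsUnitAt y ((GeneratingSections.affineChartData ψ).ratioFn i 0 (genericPoint_mem_of_mem hi) * h /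
        (GeneratingSections.affineChartData Ψ).ratioFn a j₀ (genericPoint_mem_of_mem ha) ^ m) := by
  haveI := hψ
  obtain ⟨h, hh, H⟩ := (CartierDivisor.linEquiv_iff _ _).1 hlin
  refine ⟨h, hh, fun i a y hi ha ↦ ?_⟩
  have key := H ⟨⟨i, ProjSpace.genericPoint_mem_U i⟩⟩ ⟨⟨a, genericPoint_mem_of_mem ha⟩⟩ y hi ha
  rw [CartierDivisor.pullback_f, CartierDivisor.smul_f, GeneratingSections.functionFieldMap_hyperplane_f ψ hψ
    ⟨⟨i, ProjSpace.genericPoint_mem_U i⟩⟩ (genericPoint_mem_of_mem hi)] at key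
  exact key

/-- **The cocycle identity behind condition (C)**, in `K(Z)`: for generating sections `s` (ratios
`r_{ij} = s_j/s_i`) and `t` (ratios `R_{ab} = t_b/t_a`) and any `h`,
`(r_{io} h / R_{a j₀}^m) · r_{ji} = R_{ba}^m · (r_{jo} h / R_{b j₀}^m)` (cocycle rules `r_{ji} r_{io} = r_{jo}`,
`R_{ba} R_{a j₀} = R_{b j₀}`). [folklore] -/
theorem _root_.Literature.AlgebraicGeometry.Motives.GeneratingSections.ratioFn_mul_div_pow_mul_ratioFn {Z : Scheme}
    [IsIntegral Z] {ι₁ ι₂ : Type} (G₁ : GeneratingSections ι₁ Z) (G₂ : GeneratingSections ι₂ Z) (h : Z.functionField)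
    (m : ℕ) {i j o : ι₁} {a b j₀ : ι₂} (hi : genericPoint Z ∈ G₁.U i) (hj : genericPoint Z ∈ G₁.U j)
    (ho : genericPoint Z ∈ G₁.U o) (ha : genericPoint Z ∈ G₂.U a) (hb : genericPoint Z ∈ G₂.U b)
    (hj₀ : genericPoint Z ∈ G₂.U j₀) :
    G₁.ratioFn i o hi * h / G₂.ratioFn a j₀ ha ^ m * G₁.ratioFn j i hj =
      G₂.ratioFn b a hb ^ m * (G₁.ratioFn j o hj * h / G₂.ratioFn b j₀ hb ^ m) := by
  have h1 : G₁.ratioFn i o hi ≠ 0 := G₁.ratioFn_ne_zero i o hi ho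
  have h2 : G₂.ratioFn a j₀ ha ≠ 0 := G₂.ratioFn_ne_zero a j₀ ha hj₀
  have h3 : G₂.ratioFn b j₀ hb ≠ 0 := G₂.ratioFn_ne_zero b j₀ hb hj₀
  rw [eq_div_of_mul_eq h1 (G₁.ratioFn_mul_ratioFn j i o hj hi),
    eq_div_of_mul_eq h2 (G₂.ratioFn_mul_ratioFn b a j₀ hb ha), div_pow, div_mul_div_comm, div_mul_div_comm,
    div_eq_div_iff (mul_ne_zero (pow_ne_zero _ h2) h1) (mul_ne_zero (pow_ne_zero _ h2) (pow_ne_zero _ h3))]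
  ring

end Units

/-! ### Values of regular functions at complex points -/

section Values

variable {X : SchemeOver ℂ} [IsIntegral X.left]

/-- The value at a complex point `P ∈ O(ℂ)` of the section of a rational function which is a unit at `P`
is non-zero (`P ∈ X_σ`, and a regular function does not vanish at the complex points of its basic open
set). [cite: GortzWedhorn2020, (7.11) and Prop. 3.29] -/
theorem evalOrZero_sectionOf_ne_zero {O : X.left.Opens} (hO : genericPoint X.left ∈ O) {r : X.left.functionField}
    (hr : ∀ y ∈ O, IsRegularAt y r) {P : ComplexPoints X} (hP : P.pt ∈ O) (hu : IsUnitAt P.pt r) :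
    evalOrZero O (sectionOf hO r hr) P ≠ 0 := by
  rw [evalOrZero_of_mem _ hP]
  refine (pt_mem_basicOpen_iff P hP _).1 ?_
  rw [← isUnitAt_ofSection_iff hP, ofSection_sectionOf]
  exact hu

/-- **Identities of rational functions hold for the values at complex points**: if sections `s₁, …, s₄`
over opens containing `P` satisfy `s₁ s₂ = s₃^m s₄` as rational functions, then their values at `P`
satisfy the same identity (restrict to the intersection, on which `Γ → K(X)` is injective and evaluation
at `P` is a ring homomorphism). [cite: GortzWedhorn2020, Prop. 3.29 (p. 102)] -/
theorem evalOrZero_mul_eq_pow_mul_of_ofSection {O₁ O₂ O₃ O₄ : X.left.Opens} (s₁ : Γ(X.left, O₁))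
    (s₂ : Γ(X.left, O₂)) (s₃ : Γ(X.left, O₃)) (s₄ : Γ(X.left, O₄)) {P : ComplexPoints X} (h₁ : P.pt ∈ O₁)
    (h₂ : P.pt ∈ O₂) (h₃ : P.pt ∈ O₃) (h₄ : P.pt ∈ O₄) (m : ℕ)
    (H : ofSection (genericPoint_mem_of_mem h₁) s₁ * ofSection (genericPoint_mem_of_mem h₂) s₂ =
      ofSection (genericPoint_mem_of_mem h₃) s₃ ^ m * ofSection (genericPoint_mem_of_mem h₄) s₄) :
    evalOrZero O₁ s₁ P * evalOrZero O₂ s₂ P = evalOrZero O₃ s₃ P ^ m * evalOrZero O₄ s₄ P := by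
  have hO : P.pt ∈ (O₁ ⊓ O₂) ⊓ (O₃ ⊓ O₄) := ⟨⟨h₁, h₂⟩, h₃, h₄⟩
  have e₁ : (O₁ ⊓ O₂) ⊓ (O₃ ⊓ O₄) ≤ O₁ := inf_le_left.trans inf_le_left
  have e₂ : (O₁ ⊓ O₂) ⊓ (O₃ ⊓ O₄) ≤ O₂ := inf_le_left.trans inf_le_right
  have e₃ : (O₁ ⊓ O₂) ⊓ (O₃ ⊓ O₄) ≤ O₃ := inf_le_right.trans inf_le_left
  have e₄ : (O₁ ⊓ O₂) ⊓ (O₃ ⊓ O₄) ≤ O₄ := inf_le_right.trans inf_le_right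
  rw [← evalOrZero_map_homOfLE e₁ s₁ hO, ← evalOrZero_map_homOfLE e₂ s₂ hO, ← evalOrZero_map_homOfLE e₃ s₃ hO,
    ← evalOrZero_map_homOfLE e₄ s₄ hO, evalOrZero_of_mem _ hO, evalOrZero_of_mem _ hO, evalOrZero_of_mem _ hO,
    evalOrZero_of_mem _ hO, ← evalRingHom_apply, ← evalRingHom_apply, ← evalRingHom_apply, ← evalRingHom_apply,
    ← map_mul, ← map_pow, ← map_mul]
  congr 1
  refine section_ext fun hg ↦ ?_
  simp only [map_mul, map_pow, ofSection_map]
  exact H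

end Values

/-! ### The pulled-back tautological cocycle of `ℙᴺ` along `ψ^an` -/

section Pullback

variable {n N : ℕ} {T : SchemeOver ℂ} (hT : IsSmoothProjective n T) (A : HodgeModel n T)
  (B : HodgeModel N (projectiveSpace N ℂ))
  [IsClosedImmersion (𝟙 (projectiveSpace N ℂ) : projectiveSpace N ℂ ⟶ _).left] (ψ : T ⟶ projectiveSpace N ℂ)

/-- **The trivialising sets of `(ψ^an)⁻¹𝒪_{ℙᴺ}(-1)` are the `φ⁻¹(ψ⁻¹D₊(xᵢ)(ℂ))`** (`ψ^an` lies over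
`ψ(ℂ)`, `toComplexPoints_anMap`). [cite: SerreGAGA1956, §2 n°5 (fonctorialité de X^h)] -/
theorem mem_tautologicalBundle_pullback_anMap_baseSet_iff (i : Fin (N + 1)) (x : A.carrier) :
    x ∈ ((tautologicalBundle (𝟙 (projectiveSpace N ℂ)) B.isAnalytification).pullback (HodgeModel.anMap B A ψ)
      (HodgeModel.contMDiff_anMap B A ψ hT (isSmoothProjective_projectiveSpace' N))).baseSet i ↔
      x ∈ chartDom ψ A.toComplexPoints i := by
  conv_rhs => rw [show ψ = ψ ≫ 𝟙 _ from (Category.comp_id ψ).symm]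
  exact (mem_chartDom_comp_iff ψ (𝟙 _) (HodgeModel.toComplexPoints_anMap B A ψ) i x).symm

/-- **The transition functions of `(ψ^an)⁻¹ 𝒪_{ℙᴺ}(-1)` are the `ψ^*(xᵢ/xⱼ)` read on `T^an`**: the ratios
of `ψ = ψ ≫ 𝟙` are the pulled-back ratios of `𝟙 ℙᴺ` (`coordVec_comp`). [cite: Hartshorne1977, II Thm. 7.1 (a)] -/
theorem tautologicalBundle_pullback_anMap_coordChange_apply (i j : Fin (N + 1)) (x : A.carrier) (p q : Fin 1) :
    ((tautologicalBundle (𝟙 (projectiveSpace N ℂ)) B.isAnalytification).pullback (HodgeModel.anMap B A ψ)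
      (HodgeModel.contMDiff_anMap B A ψ hT (isSmoothProjective_projectiveSpace' N))).coordChange i j x p q =
      coordFun ψ A.toComplexPoints j x i := by
  change coordFun (𝟙 _) B.toComplexPoints j (HodgeModel.anMap B A ψ x) i = _
  rw [← coordVec_apply, ← coordVec_apply, ← coordVec_comp ψ (𝟙 _) (HodgeModel.toComplexPoints_anMap B A ψ) j x]
  conv_rhs => rw [show ψ = ψ ≫ 𝟙 _ from (Category.comp_id ψ).symm]

end Pullback

end Literature.AlgebraicGeometry.HodgeTheory

end
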